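import Literature.MathematicalPhysics.QuantumFieldTheory.Balaban1983to89.B8Eq142KLevelLocal

/-!
# `Balaban1983to89.B8Eq142KLevelLocalApprox87` — [Balaban1985RegularSpaces] the (1.42) clause «|Q_j(U₀, ηA)| < 2dLα₁» (p. 83) at an
# INTERIOR constraint bond from (1.35) and an APPROXIMATE form of [Balaban1985Averaging] (87): the companion of
# `B8Eq142KLevelLocal.norm_Qj_lt_interior_loc` for a level at which (1.29) is NOT imposed

statement-level companion of published theorems with citation tags; proofs only (no `def`, no `… : Prop` fact, no existing module
modified); nothing here is a claim about the Yang–Mills mass gap.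

T. Bałaban, *Spaces of regular gauge field configurations on a lattice and gauge fixing conditions*, Commun. Math. Phys. **99** (1985)
75–102 `[Balaban1985RegularSpaces]` ((1.42) p. 83, (1.37) + (1.30)–(1.31) p. 82, (1.35) p. 82, (1.29) p. 81); T. Bałaban, *Averaging
operations for lattice gauge theories*, Commun. Math. Phys. **98** (1985) 17–51 `[Balaban1985Averaging]` ((55) p. 27, (85)–(88) p. 31,
(92) p. 31, (99) p. 32, (121)/(127) pp. 36–37).

WHY.  The tree's (1.42) device `B8Eq142KLevelLocal.norm_Qj_lt_interior_loc` (→ `B8Eq137QjEqB.norm_Qj_lt_interior`) reads, at the two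
end-points `b₋, b₊` of the constraint bond, (87) of [Balaban1985Averaging] EXACTLY: `u(Lʲb±) = w_j(b±)⁻¹` (`hm`, `hp`), `w_j =
\overline{R_{0,·}U₁}^{(j)}` the block averages (85) = the accumulated frames (99); print obtains it from (1.29) at THAT level
(`B8Eq131Derivation.eq87_of_inAx_restr129`).  With (87), (92) + (55) give `U̿₁ʲ(b) = Ũ′ʲ(b)` (`B8Eq131Derivation.eq130_interior`) and (1.35)
bounds `Ũ′ʲ(b)`.  At a level where (1.29) is REPLACED by another normalisation of the gauge (the top level of a multi-scale problem whose
top block carries a datum instead of a further constraint — the situation of [Balaban1985Variational] Sect. F (156)), (87) holds only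
APPROXIMATELY: `s_j := u(Lʲ·) · w_j` is a unit-norm-bounded field CLOSE to `1` rather than `= 1`.  The same algebra then reads
**`U̿₁ʲ(b) = s_j(b₋)⁻¹ · Ũ′ʲ(b) · R̄ʲ_{0,b} s_j(b₊)`** (§1, from (92) `B7Eq99Concrete.eq92` and (55) `B7Eq92Concrete.tildIter_mgauge`, no
hypothesis), hence `‖U̿₁ʲ(b) − 1‖ ≤ α₁ + 2σ` when `‖Ũ′ʲ(b) − 1‖ ≤ α₁` ((1.35)) and `‖s_j(b±) − 1‖ ≤ σ` (§2), and the (1.42) clause follows with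
`α₁ ↦ α₁ + 2σ` (§3 in [Balaban1985Averaging] Prop. 4's global regime, §4 in the tower-local form of `B8Eq142KLevelLocal` by the SAME clamping).
At `σ = 0` (i.e. (87)) §3/§4 are the tree's theorems with the bound's letter `α₁` unchanged.

WHAT IS CERTIFIED HERE (kernel; axioms `propext` / `Classical.choice` / `Quot.sound`):
* §1 `dbavgCovIter_eq_conj_tildIter_mgauge` — (92)+(55): `U̿₁ʲ(b) = (u_j w_j)(b₋)⁻¹ · Ũ′ʲ(b) · R(Ū₀ʲ(b))((u_j w_j)(b₊))`, `U′ := U₁^{u}` in the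
  moving frame at `U₀`, every `j`, every bond, every unit-valued data (pure algebra).
* §2 (private plumbing) `norm_conj_sub_one_le` — `‖s⁻¹·X·R(V)(s′) − 1‖ ≤ ‖X − 1‖ + ‖s − 1‖ + ‖s′ − 1‖` for `s, s′, V` in the unit-norm subgroup `U1`.
* §3 `norm_Qj_lt_interior_regular_approx87` — the twin of `B8Eq137QjEqB.norm_Qj_lt_interior_regular` with `hm`/`hp` WEAKENED to
  `s_{j+1}(b±) ∈ U1`, `‖s_{j+1}(b±) − 1‖ ≤ σ`: `‖Q_{j+1}(U₀, B)(b)‖ < 2dL(α₁ + 2σ)`.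
* §4 `norm_Qj_lt_interior_loc_approx87` — the twin of `B8Eq142KLevelLocal.norm_Qj_lt_interior_loc` (box data only) with the same weakening.

HONEST SCOPE.  Interior bonds only (both end-points at the level in question); the crossing-bond twins are not made here.  `σ` and the
`U1`-membership of `s` are HYPOTHESES: their suppliers (how close the normalised gauge is to (87) at the level in question) are the caller's.
`d ≥ 1`, `L ≥ 2`; `𝔸` a complete normed `ℂ`-algebra with `‖1‖ = 1`.  Count-neutral; nothing continuum / mass-gap / Clay.
-/

noncomputable section

open NormedSpace

namespace Literature.MathematicalPhysics.QuantumFieldTheory.Balaban1983to89.B8Eq142KLevelLocalApprox87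

open Complex (I)
open MatrixLog B7Prop1Explicit B7Prop2Explicit B7Prop1Local B7Eq92Concrete B7Eq99Concrete
open B7Prop3Flat (expCfg c3 insCfg)
open B7Prop4GeneralLevels (logCovIter)
open B7Prop5Flat (bondsIn restr mem_bondsIn insCfg_restr_of_mem agreeOn_insCfg_restr BondIn)
open B7LocalityGeneral (logCovIter_congr)
open B7AvgGaugeCovariance (uLev)
open B8Ineq130 (tlo thi tlo_apply thi_apply)
open B8Ineq132 (pdevOn_lt_of_forall)
open B8Eq137QjEqB (logCovIter_succ_eq_mlog)
open B8Ineq172Concrete (wrec_congr_tower)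
open B7Eq123General (dbavgCovIter_eq_expCfg_logCovIter level_data)
open B8Thm2LogB (Bint ineq137_interior norm_mul_inv_sub_one_le)
open B8Eq142KLevelLocal (inBox_box_of_tower_fst inBox_box_of_tower_snd)

-- `Site` alone could resolve to the torus sites of `Setup.lean`; re-export the `ℤ^d` sites of `B7Prop1Explicit`.
export B7Prop1Explicit (Site)

variable {d : ℕ}

/-! ## §1 (92) + (55): the double-bar average through the single-bar average of the gauge copy and the defect `s = u·w` of (87) -/

section Algebra

variable {𝔸 : Type*} [NormedRing 𝔸] [NormedAlgebra ℂ 𝔸] [CompleteSpace 𝔸]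

/-- **(92) + (55) WITHOUT (87).**  For every background `U₀`, every `U₁`, every gauge function `u` and `U′ := U₁^{u}` (the moving-frame
action (55) `mgauge U₀ u U₁`), at every bond `b = ⟨y, y + e_κ⟩` of the `j`-lattice:
`U̿₁ʲ(b) = s_j(y)⁻¹ · Ũ′ʲ(b) · R(Ū₀ʲ(b))(s_j(y + e_κ))`, `s_j := u(Lʲ·) · w_j`, `w_j = \overline{R_{0,·}U₁}^{(j)}` the block averages (85).
Under (87) (`s_j = 1`) this is `B8Eq131Derivation.eq130_interior`. Pure algebra: (92) `B7Eq99Concrete.eq92` and (55)/(70)–(71)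
`B7Eq92Concrete.tildIter_mgauge`. [cite: Balaban1985Averaging, (92) p.31, (55) p.27, (85)-(87) p.31; Balaban1985RegularSpaces, (1.30) p.81] -/
theorem dbavgCovIter_eq_conj_tildIter_mgauge (L : ℕ) (U₀ U₁ : Site d → Fin d → 𝔸ˣ) (u : Site d → 𝔸ˣ) (j : ℕ)
    (y : Site d) (κ : Fin d) :
    dbavgCovIter L U₀ U₁ j y κ =
      (uLev L u j y * wrec L U₀ U₁ j y)⁻¹ * tildIter L U₀ (mgauge U₀ u U₁) j y κ *
        Rc (avgIter L U₀ j y κ) (uLev L u j (y + e κ) * wrec L U₀ U₁ j (y + e κ)) := by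
  rw [← eq92 L U₀ U₁ j y κ, tildIter_mgauge, mgauge_apply, map_mul]
  group

end Algebra

/-! ## §2 The elementary norm estimate -/

section Norm

variable {𝔸 : Type*} [NormedRing 𝔸] [NormOneClass 𝔸]

/-- `‖V·X·V⁻¹ − 1‖ ≤ ‖X − 1‖` for `V` in the unit-norm subgroup. [folklore] -/
private theorem norm_Rc_sub_one_le {V X : 𝔸ˣ} (hV : V ∈ U1 𝔸) :
    ‖((Rc V X : 𝔸ˣ) : 𝔸) - 1‖ ≤ ‖(X : 𝔸) - 1‖ := by
  have he : ((Rc V X : 𝔸ˣ) : 𝔸) - 1 = (V : 𝔸) * ((X : 𝔸) - 1) * ((V⁻¹ : 𝔸ˣ) : 𝔸) := by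
    rw [Rc_apply, Units.val_mul, Units.val_mul, mul_sub, sub_mul, mul_one, Units.mul_inv]
  rw [he]
  calc _ ≤ ‖(V : 𝔸)‖ * ‖(X : 𝔸) - 1‖ * ‖((V⁻¹ : 𝔸ˣ) : 𝔸)‖ := by
        refine (norm_mul_le _ _).trans ?_
        gcongr
        exact norm_mul_le _ _
    _ ≤ 1 * ‖(X : 𝔸) - 1‖ * 1 := by gcongr; exacts [hV.1, hV.2]
    _ = _ := by ring

/-- **`‖s⁻¹·X·R(V)(s′) − 1‖ ≤ ‖X − 1‖ + ‖s − 1‖ + ‖s′ − 1‖`** for `s, s′, V ∈ U1`. [folklore] -/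
private theorem norm_conj_sub_one_le {s s' V X : 𝔸ˣ} (hs : s ∈ U1 𝔸) (hs' : s' ∈ U1 𝔸) (hV : V ∈ U1 𝔸) :
    ‖((s⁻¹ * X * Rc V s' : 𝔸ˣ) : 𝔸) - 1‖ ≤ ‖(X : 𝔸) - 1‖ + ‖(s : 𝔸) - 1‖ + ‖(s' : 𝔸) - 1‖ := by
  set R : 𝔸ˣ := Rc V s' with hR
  have hRU : R ∈ U1 𝔸 := by
    rw [hR, Rc_apply]
    exact (U1 𝔸).mul_mem ((U1 𝔸).mul_mem hV hs') ((U1 𝔸).inv_mem hV)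
  have hR1 : ‖(R : 𝔸) - 1‖ ≤ ‖(s' : 𝔸) - 1‖ := norm_Rc_sub_one_le hV
  have hsi : ‖((s⁻¹ : 𝔸ˣ) : 𝔸) - 1‖ ≤ ‖(s : 𝔸) - 1‖ := norm_inv_sub_one_le hs
  have he : ((s⁻¹ * X * R : 𝔸ˣ) : 𝔸) - 1 =
      ((s⁻¹ : 𝔸ˣ) : 𝔸) * ((X : 𝔸) - 1) * (R : 𝔸) + (((s⁻¹ : 𝔸ˣ) : 𝔸) * ((R : 𝔸) - 1) + (((s⁻¹ : 𝔸ˣ) : 𝔸) - 1)) := by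
    simp only [Units.val_mul]
    noncomm_ring
  rw [he]
  have h1 : ‖((s⁻¹ : 𝔸ˣ) : 𝔸) * ((X : 𝔸) - 1) * (R : 𝔸)‖ ≤ ‖(X : 𝔸) - 1‖ := by
    calc _ ≤ ‖((s⁻¹ : 𝔸ˣ) : 𝔸)‖ * ‖(X : 𝔸) - 1‖ * ‖(R : 𝔸)‖ := by
          refine (norm_mul_le _ _).trans ?_
          gcongr
          exact norm_mul_le _ _
      _ ≤ 1 * ‖(X : 𝔸) - 1‖ * 1 := by gcongr; exacts [hs.2, hRU.1]
      _ = _ := by ring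
  have h2 : ‖((s⁻¹ : 𝔸ˣ) : 𝔸) * ((R : 𝔸) - 1)‖ ≤ ‖(s' : 𝔸) - 1‖ := by
    calc _ ≤ ‖((s⁻¹ : 𝔸ˣ) : 𝔸)‖ * ‖(R : 𝔸) - 1‖ := norm_mul_le _ _
      _ ≤ 1 * ‖(s' : 𝔸) - 1‖ := by gcongr; exact hs.2
      _ = _ := one_mul _
  calc _ ≤ ‖((s⁻¹ : 𝔸ˣ) : 𝔸) * ((X : 𝔸) - 1) * (R : 𝔸)‖ +
        (‖((s⁻¹ : 𝔸ˣ) : 𝔸) * ((R : 𝔸) - 1)‖ + ‖((s⁻¹ : 𝔸ˣ) : 𝔸) - 1‖) :=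
        (norm_add_le _ _).trans (by gcongr; exact norm_add_le _ _)
    _ ≤ _ := by linarith

end Norm

/-! ## §3 The (1.42) clause at an interior bond from (1.35) and APPROXIMATE (87), [Balaban1985Averaging] Prop. 4's global regime -/

section Regular

variable {𝔸 : Type*} [NormedRing 𝔸] [NormOneClass 𝔸] [NormedAlgebra ℂ 𝔸] [CompleteSpace 𝔸]

/-- **«|Q_{j+1}(U₀, ηA)_b| < 2dL(α₁ + 2σ)» at an interior bond from (1.35) and APPROXIMATE (87)** — the twin of
`B8Eq137QjEqB.norm_Qj_lt_interior_regular` in which the two (87) hypotheses `u(L^{j+1}b±) = w_{j+1}(b±)⁻¹` are replaced by: the defects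
`s(b±) := u(L^{j+1}b±)·w_{j+1}(b±)` lie in the unit-norm subgroup and are `σ`-close to `1`.  Regime: `U₀ ∈ G` (`AvgClosed`) with
`pdev U₀ < α₀L^{−2k}`, exponent field `‖B₀‖ ≤ b` with `Lᵏb` in Prop. 4's window, `j + 1 ≤ k`, (1.35) at `b` for `U′ = (e^{B₀})^{u}`,
`dL(α₁ + 2σ) ≤ 1/8`. [cite: Balaban1985RegularSpaces, (1.42) p.83, (1.37) p.82, (1.35) p.82; Balaban1985Averaging, (87) p.31, (92) p.31, (127) p.37] -/
theorem norm_Qj_lt_interior_regular_approx87 (L : ℕ) (hd : 1 ≤ d) (hL : 2 ≤ L) {G : Subgroup 𝔸ˣ} (hG : AvgClosed d L G)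
    (k : ℕ) (U₀ : Site d → Fin d → 𝔸ˣ) (hU₀ : ∀ x κ, U₀ x κ ∈ G) {α₀ : ℝ} (hα₀ : 0 < α₀)
    (hα3 : C0 d * α₀ ≤ 1 / 3) (hα4 : 4 * α₀ ≤ c2' d L) (h40 : pdev U₀ < α₀ * (((L : ℝ) ^ k)⁻¹) ^ 2)
    (B₀ : Site d → Fin d → 𝔸) {b : ℝ} (hb : 0 ≤ b) (hB : ∀ x κ, ‖B₀ x κ‖ ≤ b)
    (hsm : Real.exp (4 * (800 * ((d : ℝ) + 1) ^ 2 * ((d : ℝ) + 4)) * α₀)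
      * (1 + 8 * (131072 * ((d : ℝ) + 1) ^ 2) * ((L : ℝ) ^ k * b)) ≤ 2)
    (hc₃ : 2 * ((L : ℝ) ^ k * b) ≤ c3 d L) (u : Site d → 𝔸ˣ) {j : ℕ} (hjk : j + 1 ≤ k) (y : Site d) (κ : Fin d)
    {σ : ℝ}
    (hsU : uLev L u (j + 1) y * wrec L U₀ (expCfg B₀) (j + 1) y ∈ U1 𝔸)
    (hsU' : uLev L u (j + 1) (y + e κ) * wrec L U₀ (expCfg B₀) (j + 1) (y + e κ) ∈ U1 𝔸)
    (hs : ‖((uLev L u (j + 1) y * wrec L U₀ (expCfg B₀) (j + 1) y : 𝔸ˣ) : 𝔸) - 1‖ ≤ σ)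
    (hs' : ‖((uLev L u (j + 1) (y + e κ) * wrec L U₀ (expCfg B₀) (j + 1) (y + e κ) : 𝔸ˣ) : 𝔸) - 1‖ ≤ σ)
    {α₁ : ℝ} (hα : 0 < α₁ + 2 * σ) (hsmall : (d : ℝ) * L * (α₁ + 2 * σ) ≤ 1 / 8)
    (h135 : ‖(avgIter L (mgauge U₀ u (expCfg B₀) * U₀) (j + 1) y κ : 𝔸) - (avgIter L U₀ (j + 1) y κ : 𝔸)‖ ≤ α₁) :
    ‖logCovIter L U₀ B₀ (j + 1) y κ‖ < 2 * d * L * (α₁ + 2 * σ) := by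
  have hL1 : 1 ≤ L := le_trans (by norm_num) hL
  have hId := dbavgCovIter_eq_expCfg_logCovIter L hL hG k U₀ hU₀ hα₀ hα3 hα4 h40 B₀ hb hB hsm hc₃ j (Nat.le_of_succ_le hjk)
  have h₀ : avgIter L U₀ (j + 1) y κ ∈ U1 𝔸 := (level_data L hL hG k U₀ hU₀ hα₀ hα3 hα4 h40 (j + 1) hjk).1 y κ
  -- (1.35) ⇒ `‖Ũ′^{j+1}(b) − 1‖ ≤ α₁`
  have hT : ‖((tildIter L U₀ (mgauge U₀ u (expCfg B₀)) (j + 1) y κ : 𝔸ˣ) : 𝔸) - 1‖ ≤ α₁ := by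
    rw [tildIter_apply]
    exact (norm_mul_inv_sub_one_le _ h₀).trans h135
  -- §1 + §2 ⇒ `‖U̿₁^{j+1}(b) − 1‖ ≤ α₁ + 2σ`
  set W : 𝔸ˣ := dbavgCovIter L U₀ (expCfg B₀) (j + 1) y κ with hW_def
  have hW : ‖(W : 𝔸) - 1‖ ≤ α₁ + 2 * σ := by
    rw [hW_def, dbavgCovIter_eq_conj_tildIter_mgauge L U₀ (expCfg B₀) u (j + 1) y κ]
    refine (norm_conj_sub_one_le hsU hsU' h₀).trans ?_
    linarith
  -- `Q_{j+1} = log U̿₁^{j+1} = i·B(U̿₁^{j+1})` and `B8Thm2LogB.ineq137_interior`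
  rw [logCovIter_succ_eq_mlog L U₀ B₀ j hId y κ]
  have hB : mlog ((W : 𝔸ˣ) : 𝔸) = I • Bint W := by
    rw [Bint, smul_smul, mul_inv_cancel₀ Complex.I_ne_zero, one_smul]
  rw [hB, norm_smul, Complex.norm_I, one_mul]
  exact ineq137_interior L hd hL1 hα hsmall hW

end Regular

/-! ## §4 The same from BOX DATA (tower-local form), by the clamping of `B8Eq142KLevelLocal.norm_Qj_lt_interior_loc` -/

section Local

variable {𝔸 : Type*} [NormedRing 𝔸] [NormOneClass 𝔸] [NormedAlgebra ℂ 𝔸] [CompleteSpace 𝔸]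

/-- The box `B^j(c₋) ∪ B^j(c₊)` is a genuine box: `loK ≤ bondHiK` (private copy of the lineage's lemma). [folklore] -/
private theorem loK_le_bondHiK' {L : ℕ} (hL : 1 ≤ L) (j : ℕ) (z : Site d) (κ : Fin d) :
    ∀ i, loK L j z i ≤ bondHiK L j z κ i := fun i => by
  have hP : (1 : ℤ) ≤ (L : ℤ) ^ j := one_le_pow₀ (by exact_mod_cast hL)
  simp only [loK, bondHiK]
  split_ifs <;> omega

omit [NormOneClass 𝔸] [NormedAlgebra ℂ 𝔸] [CompleteSpace 𝔸] in
/-- Agreement on a box restricts to agreement on any sub-box (private copy of the parent's plumbing). [folklore] -/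
private theorem agreeOn_of_subbox' {lo hi LO HI : Site d} {V V' : Site d → Fin d → 𝔸ˣ}
    (hsub : ∀ x, InBox lo hi x → InBox LO HI x) (h : AgreeOn LO HI V V') : AgreeOn lo hi V V' :=
  fun x κ hx hxe => h x κ (hsub x hx) (hsub _ hxe)

omit [NormOneClass 𝔸] [NormedAlgebra ℂ 𝔸] [CompleteSpace 𝔸] in
/-- The restriction `B|_{box}` (zero outside the bonds of the box) is bounded by a common bound of `B` on the box's bonds
(private copy of the parent's plumbing). [folklore] -/
private theorem norm_insCfg_restr_le'' {lo hi : Site d} {B : Site d → Fin d → 𝔸} {b : ℝ}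
    (hB : ∀ x μ, BondIn lo hi x μ → ‖B x μ‖ ≤ b) (hb : 0 ≤ b) :
    ∀ x μ, ‖insCfg (bondsIn lo hi) (restr (bondsIn lo hi) B) x μ‖ ≤ b := fun x μ => by
  by_cases h : (x, μ) ∈ bondsIn lo hi
  · rw [insCfg_restr_of_mem _ _ h]; exact hB x μ (mem_bondsIn.mp h)
  · simp only [insCfg, h, dite_false, norm_zero]; exact hb

/-- **THE (1.42) CLAUSE AT ONE INTERIOR CONSTRAINT BOND OF THE `(j+1)`-LATTICE FROM BOX DATA AND APPROXIMATE (87)** — the twin of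
`B8Eq142KLevelLocal.norm_Qj_lt_interior_loc`: `U₀` with plaquettes obeying (1.40) at level `j + 1` INSIDE the box `B^{j+1}(b₋) ∪ B^{j+1}(b₊)`,
exponent field `B` bounded by `b` on the box's bonds with `L^{j+1}b` in [Balaban1985Averaging] Prop. 4's window, the actual field `U₁`
agreeing with `e^{B}` on the box, (1.35) at `b` for `U′ = U₁^{u}`, and — in place of (87) at `b₋`, `b₊` — the defects
`s(b±) = u(L^{j+1}b±)·w_{j+1}(b±)` (`w = \overline{R_{0,·}U₁}^{(j+1)}`, (85)) in `U1` and `σ`-close to `1`: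
`‖Q_{j+1}(U₀, B)(b)‖ < 2dL(α₁ + 2σ)`.  The clamping (`B7Prop1Local.clampCfg`, the restriction of `B` to the box, `logCovIter_congr`,
`wrec_congr_tower`) is the parent's, verbatim. [cite: Balaban1985RegularSpaces, (1.42) p.83, (1.37) p.82, (1.35) p.82; Balaban1985Averaging, (87) p.31, (92) p.31, p.24 (locality)] -/
theorem norm_Qj_lt_interior_loc_approx87 (L : ℕ) (hd : 1 ≤ d) (hL : 2 ≤ L) {G : Subgroup 𝔸ˣ} (hG : AvgClosed d L G)
    (j : ℕ) (U₀ : Site d → Fin d → 𝔸ˣ) (y : Site d) (κ : Fin d)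
    (hU₀ : ∀ x μ, U₀ x μ ∈ G)
    {α₀ : ℝ} (hα₀ : 0 < α₀) (hα3 : C0 d * α₀ ≤ 1 / 3) (hα4 : 4 * α₀ ≤ c2' d L)
    (h40 : ∀ (x : Site d) (μ ν : Fin d), μ ≠ ν → PlaqIn (loK L (j + 1) y) (bondHiK L (j + 1) y κ) (x, μ, ν) →
      ‖((hol U₀ x (plaqWord μ ν) : 𝔸ˣ) : 𝔸) - 1‖ < α₀ * (((L : ℝ) ^ (j + 1))⁻¹) ^ 2)
    (B : Site d → Fin d → 𝔸) {b : ℝ} (hb : 0 ≤ b)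
    (hB : ∀ x μ, BondIn (loK L (j + 1) y) (bondHiK L (j + 1) y κ) x μ → ‖B x μ‖ ≤ b)
    (hsm : Real.exp (4 * (800 * ((d : ℝ) + 1) ^ 2 * ((d : ℝ) + 4)) * α₀)
      * (1 + 8 * (131072 * ((d : ℝ) + 1) ^ 2) * ((L : ℝ) ^ (j + 1) * b)) ≤ 2)
    (hc₃ : 2 * ((L : ℝ) ^ (j + 1) * b) ≤ c3 d L)
    (u : Site d → 𝔸ˣ) (U₁ : Site d → Fin d → 𝔸ˣ)
    (hU₁ : AgreeOn (loK L (j + 1) y) (bondHiK L (j + 1) y κ) U₁ (expCfg B))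
    {σ : ℝ}
    (hsU : uLev L u (j + 1) y * wrec L U₀ U₁ (j + 1) y ∈ U1 𝔸)
    (hsU' : uLev L u (j + 1) (y + e κ) * wrec L U₀ U₁ (j + 1) (y + e κ) ∈ U1 𝔸)
    (hs : ‖((uLev L u (j + 1) y * wrec L U₀ U₁ (j + 1) y : 𝔸ˣ) : 𝔸) - 1‖ ≤ σ)
    (hs' : ‖((uLev L u (j + 1) (y + e κ) * wrec L U₀ U₁ (j + 1) (y + e κ) : 𝔸ˣ) : 𝔸) - 1‖ ≤ σ)
    {α₁ : ℝ} (hα : 0 < α₁ + 2 * σ) (hsmall : (d : ℝ) * L * (α₁ + 2 * σ) ≤ 1 / 8)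
    (h135 : ‖(avgIter L (mgauge U₀ u U₁ * U₀) (j + 1) y κ : 𝔸) - (avgIter L U₀ (j + 1) y κ : 𝔸)‖ ≤ α₁) :
    ‖logCovIter L U₀ B (j + 1) y κ‖ < 2 * d * L * (α₁ + 2 * σ) := by
  have hL1 : 1 ≤ L := le_trans (by norm_num) hL
  set lo := loK L (j + 1) y with hlo
  set hi := bondHiK L (j + 1) y κ with hhi
  have hlohi : ∀ i, lo i ≤ hi i := loK_le_bondHiK' hL1 (j + 1) y κ
  -- the clamped background and its global data
  set U₀' := clampCfg lo hi U₀ with hU₀'_def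
  have hU₀1 : ∀ x μ, U₀ x μ ∈ U1 𝔸 := fun x μ => hG.le_U1 (hU₀ x μ)
  have hU₀'G : ∀ x μ, U₀' x μ ∈ G := clampCfg_mem hU₀
  have hpdOn : pdevOn lo hi U₀ < α₀ * (((L : ℝ) ^ (j + 1))⁻¹) ^ 2 := by
    refine pdevOn_lt_of_forall (by positivity) fun x μ ν hx hx' => ?_
    rcases eq_or_ne μ ν with rfl | hμν
    · rw [hol_plaqWord_self, Units.val_one, sub_self, norm_zero]; positivity
    · exact h40 x μ ν hμν ⟨hx, hx'⟩
  have hpdev : pdev U₀' < α₀ * (((L : ℝ) ^ (j + 1))⁻¹) ^ 2 := (pdev_clampCfg_le hlohi hU₀1).trans_lt hpdOn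
  -- the restricted exponent field and its global bound
  set B' := insCfg (bondsIn lo hi) (restr (bondsIn lo hi) B) with hB'_def
  have hB' : ∀ x μ, ‖B' x μ‖ ≤ b := norm_insCfg_restr_le'' hB hb
  -- agreements on the box
  have hagU : AgreeOn lo hi U₀' U₀ := clampCfg_agree U₀
  have hagB : AgreeOn lo hi B B' := agreeOn_insCfg_restr lo hi B
  have hagE : AgreeOn lo hi U₁ (expCfg B') := fun x μ hx hxe => by
    rw [hU₁ x μ hx hxe]
    apply Units.ext
    show exp (B x μ) = exp (B' x μ)
    rw [hagB x μ hx hxe]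
  -- the defects `s(b±)` for the clamped pair: the block averages (85) are tower-local
  have hw : ∀ z : Site d, (∀ x, InBox (tlo L z (j + 1)) (thi L z (j + 1)) x → InBox lo hi x) →
      wrec L U₀ U₁ (j + 1) z = wrec L U₀' (expCfg B') (j + 1) z := by
    intro z hsub
    exact wrec_congr_tower hL1 (agreeOn_of_subbox' hsub hagU).symm (agreeOn_of_subbox' hsub hagE) (j + 1) 0 (by omega) z
      (by rw [B8Ineq130.tlo_zero]) (by rw [B8Ineq130.thi_zero])
  have hwy : wrec L U₀ U₁ (j + 1) y = wrec L U₀' (expCfg B') (j + 1) y :=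
    hw y fun x hx => inBox_box_of_tower_fst L (j + 1) y κ hx
  have hwy' : wrec L U₀ U₁ (j + 1) (y + e κ) = wrec L U₀' (expCfg B') (j + 1) (y + e κ) :=
    hw (y + e κ) fun x hx => inBox_box_of_tower_snd (j + 1) y κ hx
  rw [hwy] at hsU hs
  rw [hwy'] at hsU' hs'
  -- (1.35) at `c` for the clamped pair: the `(j+1)`-fold averages are box-local
  have hav₁ : avgIter L (mgauge U₀' u (expCfg B') * U₀') (j + 1) y κ = avgIter L (mgauge U₀ u U₁ * U₀) (j + 1) y κ := by
    refine avgIter_congr L hL1 (j + 1) y κ fun x μ hx hxe => ?_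
    show mgauge U₀' u (expCfg B') x μ * U₀' x μ = mgauge U₀ u U₁ x μ * U₀ x μ
    rw [mgauge_apply, mgauge_apply, hagU x μ hx hxe, (hagE x μ hx hxe).symm]
  have hav₀ : avgIter L U₀' (j + 1) y κ = avgIter L U₀ (j + 1) y κ := avgIter_congr L hL1 (j + 1) y κ hagU
  have h135' : ‖(avgIter L (mgauge U₀' u (expCfg B') * U₀') (j + 1) y κ : 𝔸) - (avgIter L U₀' (j + 1) y κ : 𝔸)‖ ≤ α₁ := by
    rw [hav₁, hav₀]; exact h135
  -- the global lemma for the clamped pair at `k := j + 1`, transported back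
  have key := norm_Qj_lt_interior_regular_approx87 L hd hL hG (j + 1) U₀' hU₀'G hα₀ hα3 hα4 hpdev B' hb hB' hsm hc₃ u le_rfl y κ
    hsU hsU' hs hs' hα hsmall h135'
  rwa [logCovIter_congr L hL1 (j + 1) y κ hagU hagB.symm] at key

end Local

end Literature.MathematicalPhysics.QuantumFieldTheory.Balaban1983to89.B8Eq142KLevelLocalApprox87

end
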